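import Summits.ValiantsHypothesis.ValiantsHypothesis.Theorems.LangWeilTransferTameResolutionSylvesterSizes
import Summits.ValiantsHypothesis.ValiantsHypothesis.Theorems.LangWeilTransferTameResolutionParamExplicit

/-!
# LangWeilTransfer, support item `TameResolution` (stmt-ValiantsHypothesis-6378) — sizes of the
# resultant `Res_U(q, q')`, of the Bézout cofactor `B` and of the specialisation point `c`

Route `LangWeilTransfer` of `ValiantsHypothesis` (conditional route; honest framing: bookkeeping,
nothing here bears on VP ≠ VNP). Quantitative pass, second link of the size chain (roadmap note
of val-lit-p6 g9, §4 (S)): from the sizes of `q` (`q_sizes`: `deg_U q ≤ N`, flattened coefficients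
of total degree `≤ D'` and weight `≤ W'`, `1 ≤ W'`) we bound, for the data of
`exists_parametrisation_explicit`,
* `flat₁ Res` (`Res = resultant q q' (deg q) (deg q')`): weight `≤ (2N)! (N W')^{2N}`, degree `≤ 2N D'`;
* `flat₁ (B.coeff i)` (adjugate entries of the Sylvester matrix): the same bounds;
* the `Λ`-degree of `Res · lc q`, hence the specialisation point: `c_j ≤ 2N D' + D'`.
All maps commute with the injective flattening `flat₁ : ℤ[T][Λ] → ℤ[Fin (n+r)]`
(`resultant_map_map`, `sylvester_map_map`, `RingHom.map_adjugate`, `derivative_map`).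

* `res_B_sizes`.
-/

noncomputable section

open MvPolynomial
open Literature.Computability.AlgebraicComplexity

-- the summit and the problem share the name `ValiantsHypothesis` (D-0017 single-conjunct layout)
set_option linter.dupNamespace false

namespace Summit.ValiantsHypothesis.ValiantsHypothesis.Theorems.LangWeilTransfer

variable {r n : ℕ}

/-- **Sizes of `Res`, `B`, `lc q` and `c`.** See the module docstring. -/
theorem res_B_sizes (q B : Polynomial (MvPolynomial (Fin n) (MvPolynomial (Fin r) ℤ))) {N D' W' : ℕ}
    (hN : 1 ≤ N) (hW' : 1 ≤ W') (hqN : q.natDegree ≤ N)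
    (hqD : ∀ i, (rename finSumFinEquiv ((sumAlgEquiv ℤ (Fin n) (Fin r)).symm (q.coeff i))).totalDegree ≤ D')
    (hqW : ∀ i, weight (rename finSumFinEquiv ((sumAlgEquiv ℤ (Fin n) (Fin r)).symm (q.coeff i))) ≤ W')
    (hB : ∀ i : ℕ, B.coeff i = if h : i < q.natDegree then
      (Polynomial.sylvester q (Polynomial.derivative q) q.natDegree (Polynomial.derivative q).natDegree).adjugate
        (Fin.castAdd _ ⟨i, h⟩) ⟨0, by omega⟩ else 0)
    (c : Fin n → ℕ)
    (hc : ∀ j, c j ≤ (Polynomial.resultant q (Polynomial.derivative q) q.natDegree (Polynomial.derivative q).natDegree *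
      q.leadingCoeff).totalDegree) :
    let flat₁ : MvPolynomial (Fin n) (MvPolynomial (Fin r) ℤ) →+* MvPolynomial (Fin (n + r)) ℤ :=
      (rename finSumFinEquiv : MvPolynomial (Fin n ⊕ Fin r) ℤ →ₐ[ℤ] MvPolynomial (Fin (n + r)) ℤ).toRingHom.comp
        (sumAlgEquiv ℤ (Fin n) (Fin r)).symm.toRingEquiv.toRingHom
    let Res := Polynomial.resultant q (Polynomial.derivative q) q.natDegree (Polynomial.derivative q).natDegree
    weight (flat₁ Res) ≤ (2 * N).factorial * (N * W') ^ (2 * N) ∧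
    (flat₁ Res).totalDegree ≤ 2 * N * D' ∧
    (∀ i, weight (flat₁ (B.coeff i)) ≤ (2 * N).factorial * (N * W') ^ (2 * N)) ∧
    (∀ i, (flat₁ (B.coeff i)).totalDegree ≤ 2 * N * D') ∧
    (∀ j, c j ≤ 2 * N * D' + D') := by
  intro flat₁ Res
  classical
  have hflat : ∀ g, flat₁ g = rename finSumFinEquiv ((sumAlgEquiv ℤ (Fin n) (Fin r)).symm g) := fun g => rfl
  -- the flattened polynomial and its derivative
  set qf := q.map flat₁ with hqf
  have hder : (Polynomial.derivative q).map flat₁ = Polynomial.derivative qf := by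
    rw [hqf, Polynomial.derivative_map]
  have hqfN : qf.natDegree ≤ N := (Polynomial.natDegree_map_le).trans hqN
  have hWc1 : 1 ≤ N * W' := Nat.le_trans hN (Nat.le_mul_of_pos_right _ hW')
  have hq_w : ∀ k, weight (qf.coeff k) ≤ N * W' := by
    intro k; rw [hqf, Polynomial.coeff_map, hflat]
    exact (hqW k).trans (Nat.le_mul_of_pos_left _ hN)
  have hq_w' : ∀ k, weight (qf.coeff k) ≤ W' := by
    intro k; rw [hqf, Polynomial.coeff_map, hflat]; exact hqW k
  have hq'_w : ∀ k, weight ((Polynomial.derivative qf).coeff k) ≤ N * W' :=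
    fun k => weight_coeff_derivative_le qf hq_w' hqfN k
  have hq_d : ∀ k, (qf.coeff k).totalDegree ≤ D' := by
    intro k; rw [hqf, Polynomial.coeff_map, hflat]; exact hqD k
  have hq'_d : ∀ k, ((Polynomial.derivative qf).coeff k).totalDegree ≤ D' :=
    fun k => totalDegree_coeff_derivative_le qf hq_d k
  -- `m + n' ≤ 2N`
  set m := q.natDegree with hm
  set n' := (Polynomial.derivative q).natDegree with hn'
  have hmn : m + n' ≤ 2 * N := by
    have h1 : n' ≤ N := by
      rw [hn']
      exact ((Polynomial.natDegree_derivative_le q).trans (Nat.sub_le _ _)).trans hqN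
    omega
  have hbound : (m + n').factorial * (N * W') ^ (m + n') ≤ (2 * N).factorial * (N * W') ^ (2 * N) :=
    Nat.mul_le_mul (Nat.factorial_le hmn) (Nat.pow_le_pow_right hWc1 hmn)
  -- the resultant
  have hResf : flat₁ Res = Polynomial.resultant qf (Polynomial.derivative qf) m n' := by
    rw [← hder, hqf, Polynomial.resultant_map_map]
  -- the Sylvester matrix and its adjugate under `flat₁`
  have hSylf : flat₁.mapMatrix (Polynomial.sylvester q (Polynomial.derivative q) m n') =
      Polynomial.sylvester qf (Polynomial.derivative qf) m n' := by
    rw [← hder, hqf, Polynomial.sylvester_map_map]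
  have hadjf : ∀ i0 k0, flat₁ ((Polynomial.sylvester q (Polynomial.derivative q) m n').adjugate i0 k0) =
      (Polynomial.sylvester qf (Polynomial.derivative qf) m n').adjugate i0 k0 := by
    intro i0 k0
    have h := RingHom.map_adjugate flat₁ (Polynomial.sylvester q (Polynomial.derivative q) m n')
    rw [hSylf] at h
    have h' := congrArg (fun M => M i0 k0) h
    simpa only [RingHom.mapMatrix_apply, Matrix.map_apply] using h'
  refine ⟨?_, ?_, fun i => ?_, fun i => ?_, fun j => ?_⟩
  · rw [hResf]
    exact (weight_resultant_le qf (Polynomial.derivative qf) hq_w hq'_w).trans hbound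
  · rw [hResf]
    refine (totalDegree_resultant_le qf (Polynomial.derivative qf) hq_d hq'_d).trans ?_
    exact Nat.mul_le_mul_right _ hmn
  · rw [hB i]
    split_ifs with h
    · rw [hadjf]
      exact (weight_adjugate_sylvester_le qf (Polynomial.derivative qf) hWc1 hq_w hq'_w _ _).trans hbound
    · rw [map_zero, weight_zero]; exact Nat.zero_le _
  · rw [hB i]
    split_ifs with h
    · rw [hadjf]
      refine (totalDegree_adjugate_sylvester_le qf (Polynomial.derivative qf) hq_d hq'_d _ _).trans ?_
      exact Nat.mul_le_mul_right _ hmn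
    · rw [map_zero, totalDegree_zero]; exact Nat.zero_le _
  · -- `c_j ≤ deg_Λ (Res · lc q) ≤ deg (flat₁ (Res · lc q)) ≤ 2N D' + D'`
    refine (hc j).trans ?_
    have houter : ∀ g : MvPolynomial (Fin n) (MvPolynomial (Fin r) ℤ), g.totalDegree ≤ (flat₁ g).totalDegree := by
      intro g
      rw [hflat]
      have h1 : g.totalDegree ≤ ((sumAlgEquiv ℤ (Fin n) (Fin r)).symm g).totalDegree := by
        have := totalDegree_sumAlgEquiv_le (R := ℤ) ((sumAlgEquiv ℤ (Fin n) (Fin r)).symm g)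
        rwa [AlgEquiv.apply_symm_apply] at this
      refine h1.trans ?_
      have h2 := totalDegree_rename_le (finSumFinEquiv (m := n) (n := r)).symm
        (rename finSumFinEquiv ((sumAlgEquiv ℤ (Fin n) (Fin r)).symm g))
      rw [rename_rename, Equiv.symm_comp_self, rename_id] at h2
      exact h2
    refine (houter _).trans ?_
    rw [map_mul]
    refine (totalDegree_mul _ _).trans (Nat.add_le_add ?_ ?_)
    · rw [hResf]
      refine (totalDegree_resultant_le qf (Polynomial.derivative qf) hq_d hq'_d).trans ?_
      exact Nat.mul_le_mul_right _ hmn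
    · rw [Polynomial.leadingCoeff, hflat]
      exact hqD _

end Summit.ValiantsHypothesis.ValiantsHypothesis.Theorems.LangWeilTransfer
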